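import Summits.HubbardSuperconductivity.HubbardSuperconductivity.Theorems.NodalDiracTwistNodalDiracWeakCouplingOfUniqParity

/-!
# Promotion package (lead c16): the crux `NodalDiracWeakCoupling` in minimal form — `NodalDiracUniqParity`

Route `HubbardSuperconductivity/NodalDiracTwist`, crux stmt-HubbardSuperconductivity-10370. For the
planner / strategist: the statement below is the right-hand side of the LANDED equivalence
`nodalDiracWeakCoupling_iff_uniqParity` (p166608, `Theorems/…OfUniqParity.lean`), i.e. the crux with
the whole holonomy / cone / two-foldness / existence-of-degeneracy apparatus stripped off by
kernel-checked theorems. It is the registered stub `stub_uniqParity` of skeleton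
`Lines/birth.lean` v10 verbatim. Filing it as the route's crux-2 statement (restating 10370) or as a
`@[conjecture]` item changes nothing logically (`nodalDiracWeakCoupling_iff_NodalDiracUniqParity`
below) and says honestly what is open:

* UNIQ — at every twist `φ` of the closed triangle `0 ≤ φ₁ ≤ φ₀ ≤ π` other than `(c, c)` the
  `(N_L, S^z = 0)`-sector ground state of the spin-twisted torus `H_L(U, φ)` is unique up to scalars
  (no level crossing anywhere off the node image — the finite-size signature of "no Fermi surface,
  point nodes on the zone diagonal");
* NC1 — the `(N_L, S^z = 0)` ground states of `H_L(U, (0,0)) = hubbardTorus 2 L 1 U` (periodic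
  b.c.) and of `H_L(U, (π,π))` (spin-gauge equivalent to the doubly antiperiodic torus) have
  OPPOSITE `x₀ ↔ x₁` reflection parity (one bit per `L`; BdG: the number of occupied swap-fixed pair
  channels `(2πj/L)(1,1)` is `2⌊Lκ/2π⌋ + 1` on the periodic grid and even on the half-shifted grid,
  both well defined exactly by non-resonance to `πℤ`).

`Literature.Barriers.HubbardSuperconductivity.WeakCouplingCeiling` applies to it verbatim
(`L₀ ~ ξ ~ e^{C/U²}`); at fixed `L` and `U → 0` UNIQ is false (open-shell triplet strips: a
codimension-1 degeneracy net), so `L₀(U) → ∞` is forced. No definitions beyond the abbreviation.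
-/

-- the mandated namespace repeats `HubbardSuperconductivity` (single-problem summit, D-0017)
set_option linter.dupNamespace false

noncomputable section

namespace Summit.HubbardSuperconductivity.HubbardSuperconductivity.Cruxes.NodalDiracWeakCoupling.Birth

open Literature.MathematicalPhysics.QuantumLattice Literature.Probability.LatticeModels Matrix
open Summit.HubbardSuperconductivity.HubbardSuperconductivity.Theses.NodalDiracTwist
open Summit.HubbardSuperconductivity.HubbardSuperconductivity.Theorems.NodalDiracTwist

/-- **`NodalDiracUniqParity`** — the crux `NodalDiracWeakCoupling` in minimal equivalent form
(UNIQ ∧ NC1); candidate restatement of stmt-HubbardSuperconductivity-10370. -/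
def NodalDiracUniqParity : Prop :=
  ∀ U₀ : ℝ, 0 < U₀ → ∃ U ∈ Set.Ioo (0 : ℝ) U₀, ∃ δ ∈ Set.Icc (1 / 10 : ℝ) (3 / 10),
    ∃ κ : ℝ, 0 < κ ∧ κ < Real.pi ∧ Real.cos κ ≠ 0 ∧ ∀ ε : ℝ, 0 < ε → ∃ L₀ : ℕ,
      ∀ (L : ℕ) [NeZero L], Even L → L₀ ≤ L → (∀ m : ℤ, ε ≤ |L * κ - m * Real.pi|) →
        ∃ c : ℝ, 0 < c ∧ c < Real.pi ∧ |Real.cos c - Real.cos (L * κ)| ≤ ε ∧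
          (∀ φ : Fin 2 → ℝ, 0 ≤ φ 1 → φ 1 ≤ φ 0 → φ 0 ≤ Real.pi → ¬ (φ 0 = c ∧ φ 1 = c) →
            ∀ χ₁ χ₂ : Fock (Orb (FermionTorus 2 L)),
              IsGroundStateInSector (spinTwistedHubbardTorus L U φ) (2 * ⌊(1 - δ) * (L : ℝ) ^ 2 / 2⌋₊) 0 χ₁ →
              IsGroundStateInSector (spinTwistedHubbardTorus L U φ) (2 * ⌊(1 - δ) * (L : ℝ) ^ 2 / 2⌋₊) 0 χ₂ →
              ∃ z : ℂ, χ₂ = z • χ₁) ∧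
          (∃ χ₀ χπ : Fock (Orb (FermionTorus 2 L)),
              IsGroundStateInSector (spinTwistedHubbardTorus L U (fun _ : Fin 2 => (0 : ℝ))) (2 * ⌊(1 - δ) * (L : ℝ) ^ 2 / 2⌋₊) 0 χ₀ ∧
              IsGroundStateInSector (spinTwistedHubbardTorus L U (fun _ : Fin 2 => Real.pi)) (2 * ⌊(1 - δ) * (L : ℝ) ^ 2 / 2⌋₊) 0 χπ ∧
              (((@fockD4 L _ (DihedralGroup.sr 3)).val *ᵥ χ₀ = χ₀ ∧
                  (@fockD4 L _ (DihedralGroup.sr 3)).val *ᵥ χπ = -χπ) ∨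
                ((@fockD4 L _ (DihedralGroup.sr 3)).val *ᵥ χ₀ = -χ₀ ∧
                  (@fockD4 L _ (DihedralGroup.sr 3)).val *ᵥ χπ = χπ)))

/-- The crux is equivalent to `NodalDiracUniqParity` (the landed
`nodalDiracWeakCoupling_iff_uniqParity`, restated for the abbreviation). -/
theorem nodalDiracWeakCoupling_iff_NodalDiracUniqParity :
    NodalDiracWeakCoupling ↔ NodalDiracUniqParity :=
  nodalDiracWeakCoupling_iff_uniqParity

/-- If the planner files `NodalDiracUniqParity` as an item, crux 10370 closes by this one-liner. -/
theorem nodalDiracWeakCoupling_of_NodalDiracUniqParity (h : NodalDiracUniqParity) :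
    NodalDiracWeakCoupling :=
  nodalDiracWeakCoupling_of_uniqParity h

end Summit.HubbardSuperconductivity.HubbardSuperconductivity.Cruxes.NodalDiracWeakCoupling.Birth

end
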